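import Mathlib
import Summits.ResolutionOfSingularities.ResolutionOfSingularities.Theorems.WeightedInvariantLocalWeightedDropTOT2StepBlowOne

/-!
# TOT2-LINE (P3) B6 step 5/6: THE TRANSLATED-POINT ANSWER — the budget does not rise, and drops at a conflict

Sub-problem `ResolutionOfSingularities`, ENGINE crux `stmt-ResolutionOfSingularities-8899` (`LocalWeightedDrop`), skeleton v35 (2e806da509994632),
registered stub `stub_conflictBudget` (P3); plan `L/res-L1-w43-stub-2/g6/B6-PLAN.md` §1, §4.  [OURS · L1 W4.3 · chain w43 · res-L1-w43-stub-2 g6 (owner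
of (P3)); def-free; the bricks B3 / B4 / D3 v2 / injectivity of `comap` for the COMPOSITE chart `Φ = chartOne ∘ recentre ψ ∘ shear (c)` are taken as
typed HYPOTHESES on an abstract `k`-algebra endomorphism `Φ` of `k⟦u₁,u₂,y⟧` (only `Φ u₁ = u₁`, `Φ u₂ = u₁ (u₂ + c)`, and `Φ (toThree g) =
toThree (g(u₁, u₁(u₂ + c)))` are used), to be discharged by name in the glue; nothing here is a statement of any manuscript; AI-produced,
gate-checked, weaker than expert review.]

Successor label `A′` (abstract here; in the glue `A′ = blowOneT d (shift d (shearT (C c) A) ψ)`), `N′ = {0}`, `c ≠ 0`.  For a surviving branch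
`P′`, `P = Φ⁻¹P′` satisfies `v_{P′}(u₁) = v_P(u₁)` and `v_{P′}(u₁) + v_{P′}(u₂) = v_P(u₂ − c u₁)` (B3 + the two displayed values of `Φ`), and `u₂ ∉ P`
automatically (`Φ u₂ = u₁ · unit`).  The letter bit upstairs is `β′ = [V(y,u₂) permissible for A′]`:
* `β′ = 0`: the new charge is `2a′ = 2a ≤` the old one, with slack `β·κ(P)` (`row_translated`);
* `β′ = 1`: the line prime `L′ ∋ u₂` of `A′` (hypothesis `hline` = D6c + its dimension) pulls back to a DYING one-dimensional non-line prime
  `P_ℓ ∋ u₂ − c u₁` of `A`, not hit by any survivor (injectivity), and D7 (`dvd_of_toThree_mem`) gives `pair(P, P_ℓ) ≥ v_P(u₂ − c u₁) = a′ + b′`,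
  which pays the births `2(b′ − m′) + κ′ ≤ 2b′ − 1` with slack.
At a conflict the transverse branch `P₀` (`a = 1`, D5) either dies (charge `≥ 2`) or survives with `κ(P₀) = 1` (equality case of the ultrametric
inequality, `branchVal_X_one_eq_one_of_contact`), whence strictness.  Also filed here: the dimension of "graph-like" primes
(`ringKrullDim_quotient_eq_one_of_cong`) and D6c with dimension (`exists_linePrimeD_of_isPermissibleTwoT`), which discharge `hline` in the glue.
* `conflictBudgetD_translated_le`, `conflictBudgetD_translated_lt`.
-/

set_option linter.dupNamespace false -- mandated namespace of this single-conjunct summit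

noncomputable section

namespace Summit.ResolutionOfSingularities.ResolutionOfSingularities.Theorems

namespace TOT2Branch

open MvPowerSeries IsLocalRing PolyDescent Literature.AlgebraicGeometry.Resolution

variable {k : Type} [Field k]

/-! ## Small tools -/

/-- `v_P(−f) = v_P(f)`. -/
theorem branchVal_neg (P : Ideal (MvPowerSeries (Fin 3) k)) (f : MvPowerSeries (Fin 3) k) : branchVal P (-f) = branchVal P f := by
  unfold branchVal
  split_ifs with hP hW
  · rw [map_neg, map_neg, AddValuation.map_neg]
  · rfl
  · rfl

/-- The ultrametric inequality on a one-dimensional prime. -/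
theorem min_branchVal_le_add_of_dim {P : Ideal (MvPowerSeries (Fin 3) k)} [P.IsPrime] (hdim : ringKrullDim (MvPowerSeries (Fin 3) k ⧸ P) = 1)
    (f g : MvPowerSeries (Fin 3) k) : min (branchVal P f) (branchVal P g) ≤ branchVal P (f + g) := by
  rw [branchVal_eq_addVal_of_dim hdim, branchVal_eq_addVal_of_dim hdim, branchVal_eq_addVal_of_dim hdim]
  exact min_addVal_mk_le_add P hdim f g

/-- Non-zero constants have value `0` on a one-dimensional prime. -/
theorem branchVal_C_of_dim {P : Ideal (MvPowerSeries (Fin 3) k)} [P.IsPrime] (hdim : ringKrullDim (MvPowerSeries (Fin 3) k ⧸ P) = 1)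
    {c : k} (hc : c ≠ 0) : branchVal P (C c) = 0 := by
  rw [branchVal_eq_addVal_of_dim hdim]; exact addVal_mk_C P hdim hc

/-- **Equality case of the ultrametric inequality for `u₂ = (u₂ − c·u₁) + c·u₁`:** on a one-dimensional prime with `v(u₁) = 1` and
`v(u₂ − u₁·c) ≥ 2` (`c ≠ 0`), `v(u₂) = 1`. -/
theorem branchVal_X_one_eq_one_of_contact {P : Ideal (MvPowerSeries (Fin 3) k)} [P.IsPrime]
    (hdim : ringKrullDim (MvPowerSeries (Fin 3) k ⧸ P) = 1) {c : k} (hc : c ≠ 0)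
    (h0 : branchVal P (X 0) = 1) (h2 : 2 ≤ branchVal P (X 1 - X 0 * C c)) : branchVal P (X 1) = 1 := by
  have hXc : branchVal P (X 0 * C c) = 1 := by rw [branchVal_mul_of_dim hdim, h0, branchVal_C_of_dim hdim hc, add_zero]
  refine le_antisymm ?_ (one_le_branchVal_X_of_dim hdim 1)
  by_contra hlt
  have h2' : (2 : ℕ∞) ≤ branchVal P (X 1) := by
    have h := Order.add_one_le_of_lt (not_le.mp hlt)
    rwa [one_add_one_eq_two] at h
  have hmin := min_branchVal_le_add_of_dim hdim (X 1) (-(X 1 - X 0 * C c))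
  rw [branchVal_neg, show (X 1 : MvPowerSeries (Fin 3) k) + -(X 1 - X 0 * C c) = X 0 * C c by ring, hXc] at hmin
  have h21 : (2 : ℕ∞) ≤ 1 := le_trans (le_min h2' h2) hmin
  exact absurd h21 (by decide)

/-- The embedding of plane series fixes constants. -/
theorem toThree_C (c : k) : toThree (C c : MvPowerSeries (Fin 2) k) = C c := toThree.commutes c

/-! ## The dimension of graph-like primes; D6c with dimension -/

/-- A prime `P ∌ u₁` modulo which every series is congruent to a `u₂`-free plane series has a one-dimensional quotient: the branch ring is a
Noetherian local domain whose maximal ideal is principal (`= (ū₁)`, `maximalIdeal_quotient_eq_span`) and non-zero. -/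
theorem ringKrullDim_quotient_eq_one_of_cong {P : Ideal (MvPowerSeries (Fin 3) k)} [hP : P.IsPrime]
    (hX : (X 0 : MvPowerSeries (Fin 3) k) ∉ P)
    (hcong : ∀ f : MvPowerSeries (Fin 3) k, ∃ g : MvPowerSeries (Fin 2) k, (∀ e : Fin 2 →₀ ℕ, e 1 ≠ 0 → coeff e g = 0) ∧ f - toThree g ∈ P) :
    ringKrullDim (MvPowerSeries (Fin 3) k ⧸ P) = 1 := by
  haveI := isLocalRing_quotient P
  haveI := isNoetherianRing_quotient P
  have hmax := maximalIdeal_quotient_eq_span hcong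
  have hprinc : (maximalIdeal (MvPowerSeries (Fin 3) k ⧸ P)).IsPrincipal := by rw [hmax]; exact ⟨⟨_, rfl⟩⟩
  haveI : IsPrincipalIdealRing (MvPowerSeries (Fin 3) k ⧸ P) :=
    ((tfae_of_isNoetherianRing_of_isLocalRing_of_isDomain (MvPowerSeries (Fin 3) k ⧸ P)).out 0 4).mpr hprinc
  refine IsPrincipalIdealRing.ringKrullDim_eq_one _ fun hF => hX ?_
  have hbot := IsLocalRing.isField_iff_maximalIdeal_eq.mp hF
  have hmem : Ideal.Quotient.mk P (X 0) ∈ maximalIdeal (MvPowerSeries (Fin 3) k ⧸ P) := by rw [hmax]; exact Ideal.subset_span rfl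
  rw [hbot, Ideal.mem_bot] at hmem
  exact Ideal.Quotient.eq_zero_iff_mem.mp hmem

/-- **D6c WITH DIMENSION**: if `V(y,u₂)` is permissible for the label `A`, its top locus has a ONE-DIMENSIONAL prime containing `u₂` and not `u₁`
(the prime of the graph datum `h = 0`, `ψ = 0`). -/
theorem exists_linePrimeD_of_isPermissibleTwoT {d : ℕ} {A : Fin d → MvPowerSeries (Fin 2) k} (h2 : IsPermissibleTwoT d A) :
    ∃ P ∈ topPrimes d A, (X 1 : MvPowerSeries (Fin 3) k) ∈ P ∧ (X 0 : MvPowerSeries (Fin 3) k) ∉ P ∧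
      ringKrullDim (MvPowerSeries (Fin 3) k ⧸ P) = 1 := by
  have hperm : IsPermissibleTwoT d (WildMonic.shift d (shearT 0 A) 0) := by
    rwa [shearT_zero, WildMonic.shift_zero]
  have hh : ∀ e : Fin 2 →₀ ℕ, e 1 ≠ 0 → coeff e (0 : MvPowerSeries (Fin 2) k) = 0 := fun _ _ => by simp
  obtain ⟨P, hP, hX0, hX1, hF, -, hcong⟩ := exists_graphPrime A hh (by simp) hperm
  haveI := hP
  have hX1' : (X 1 : MvPowerSeries (Fin 3) k) ∈ P := by simpa using hX1
  refine ⟨P, ⟨hP, fun h => hX0 (h ▸ X_mem_maximalIdeal k (Fin 3) 0), 1, fun h1 => hP.ne_top ((Ideal.eq_top_iff_one P).mpr h1),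
    by rwa [one_mul]⟩, hX1', hX0, ringKrullDim_quotient_eq_one_of_cong hX0 hcong⟩

/-! ## The step theorem -/

section Step

variable {d : ℕ} {A A' : Fin d → MvPowerSeries (Fin 2) k} {N N' : Finset (Fin 2)}
  (Φ : MvPowerSeries (Fin 3) k →ₐ[k] MvPowerSeries (Fin 3) k)

/-- **B6 STEP TRANSLATED POINT, WITH SLACK.**  Under the context for `(A, N)` and the bricks B3 / B4 / D3 / injectivity for an abstract chart `Φ`
with `Φ u₁ = u₁`, `Φ u₂ = u₁(u₂ + c)` (`c ≠ 0`), `Φ (toThree g) = toThree (g(u₁, u₁(u₂ + c)))`, and the line-prime hypothesis `hline` for the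
successor label `A′` with `N′ = {0}`: `M′ ≤ M`, and `M′ < M` as soon as `β = 1` and some one-dimensional non-line top-locus prime of `A` has
`v(u₁) = 1`. -/
theorem conflictBudgetD_translated_le (p : ℕ) [Fact p.Prime] [CharP k p] [IsAlgClosed k] {c : k} (hc0 : c ≠ 0)
    (hΦX0 : Φ (X 0) = X 0) (hΦX1 : Φ (X 1) = X 0 * (X 1 + C c))
    (hΦ₂ : ∀ g : MvPowerSeries (Fin 2) k,
      Φ (toThree g) = toThree (subst (![X 0, X 0 * (X 1 + C c)] : Fin 2 → MvPowerSeries (Fin 2) k) g))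
    (hB3 : ∀ (P' : Ideal (MvPowerSeries (Fin 3) k)) [P'.IsPrime], ringKrullDim (MvPowerSeries (Fin 3) k ⧸ P') = 1 →
      (X 0 : MvPowerSeries (Fin 3) k) ∉ P' →
      ringKrullDim (MvPowerSeries (Fin 3) k ⧸ P'.comap Φ) = 1 ∧ ∀ f, branchVal (P'.comap Φ) f = branchVal P' (Φ f))
    (hB4 : ∀ (P' : Ideal (MvPowerSeries (Fin 3) k)), P' ∈ topPrimes d A' → (X 0 : MvPowerSeries (Fin 3) k) ∉ P' →
      P'.comap Φ ∈ topPrimes d A)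
    (hD3 : ∀ (P Q : Ideal (MvPowerSeries (Fin 3) k)), P ∈ topPrimes d A → Q ∈ topPrimes d A → P ≠ Q →
      ringKrullDim (MvPowerSeries (Fin 3) k ⧸ P) = 1 → ringKrullDim (MvPowerSeries (Fin 3) k ⧸ Q) = 1 → pairVal P Q < ⊤)
    (hinj : ∀ (P' Q' : Ideal (MvPowerSeries (Fin 3) k)), P'.IsPrime → Q'.IsPrime → ringKrullDim (MvPowerSeries (Fin 3) k ⧸ P') = 1 →
      ringKrullDim (MvPowerSeries (Fin 3) k ⧸ Q') = 1 → (X 0 : MvPowerSeries (Fin 3) k) ∉ P' → (X 0 : MvPowerSeries (Fin 3) k) ∉ Q' →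
      P'.comap Φ = Q'.comap Φ → P' = Q')
    (hline : IsPermissibleTwoT d A' → ∃ L' ∈ topPrimes d A', (X 1 : MvPowerSeries (Fin 3) k) ∈ L' ∧
      (X 0 : MvPowerSeries (Fin 3) k) ∉ L' ∧ ringKrullDim (MvPowerSeries (Fin 3) k ⧸ L') = 1)
    (hctx : ∃ (b : MvPowerSeries (Fin (2 + 1)) k) (δ : TameFourTupleDrop.Decoration k 2) (Θ : Fin (2 + 1) → MvPowerSeries (Fin (2 + 1)) k),
      TameFourTupleDrop.Admissible b δ ∧ 2 ≤ δ.o ∧ δ.c = d ∧ δ.PresBy d A N Θ)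
    (hN' : N' = {0}) :
    conflictBudgetD d A' N' ≤ conflictBudgetD d A N ∧
      ∀ P₀ ∈ topPrimesDNL d A, 1 ≤ betaTwo d A N → branchVal P₀ (X 0) = 1 →
        conflictBudgetD d A' N' < conflictBudgetD d A N := by
  classical
  have hd2 : 2 ≤ d := NCBranchPrimes.two_le_of_presContext hctx
  have hsq : Squarefree (NCPoly.monicGerm d A) := NCBranchPrimes.squarefree_monicGerm_of_presContext hctx
  -- `Φ` on the test functions
  have hΦC : Φ (C c) = C c := Φ.commutes c
  have hΦℓ : Φ (X 1 - X 0 * C c) = X 0 * X 1 := by rw [map_sub, map_mul, hΦX0, hΦX1, hΦC]; ring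
  have hunit : IsUnit (X 1 + C c : MvPowerSeries (Fin 3) k) := by
    rw [MvPowerSeries.isUnit_iff_constantCoeff]; simp [hc0]
  -- the index sets
  have hfinS : (topPrimesDNL d A).Finite := (topPrimesNL_finite p hctx).subset (topPrimesDNL_subset_topPrimesNL d A)
  set ι : Ideal (MvPowerSeries (Fin 3) k) → Ideal (MvPowerSeries (Fin 3) k) := fun P' => P'.comap Φ with hιdef
  have hιmem' : ∀ P' : Ideal (MvPowerSeries (Fin 3) k), P' ∈ topPrimes d A' → ringKrullDim (MvPowerSeries (Fin 3) k ⧸ P') = 1 →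
      (X 0 : MvPowerSeries (Fin 3) k) ∉ P' → ι P' ∈ topPrimesDNL d A := by
    intro P' hP'top hdim' hX0'
    haveI := hP'top.1
    obtain ⟨hdim, -⟩ := hB3 P' hdim' hX0'
    refine ⟨⟨hB4 P' hP'top hX0', hdim⟩, ?_, ?_⟩
    · rw [hιdef, Ideal.mem_comap]; show Φ (X 0) ∉ P'; rw [hΦX0]; exact hX0'
    · rw [hιdef, Ideal.mem_comap]; show Φ (X 1) ∉ P'; rw [hΦX1]
      exact fun h => (hP'top.1.mem_or_mem h).elim hX0' fun h1 => hP'top.1.ne_top (Ideal.eq_top_of_isUnit_mem _ h1 hunit)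
  have hιmem : ∀ P' ∈ topPrimesDNL d A', ι P' ∈ topPrimesDNL d A := fun P' hP' => hιmem' P' hP'.1.1 hP'.1.2 hP'.2.1
  have hinjOn : Set.InjOn ι (topPrimesDNL d A') := by
    intro P' hP' Q' hQ' h
    exact hinj P' Q' hP'.1.1.1 hQ'.1.1.1 hP'.1.2 hQ'.1.2 hP'.2.1 hQ'.2.1 h
  have hfinS' : (topPrimesDNL d A').Finite :=
    Set.Finite.of_finite_image (hfinS.subset (fun P hP => by obtain ⟨P', hP', rfl⟩ := hP; exact hιmem P' hP')) hinjOn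
  set S := hfinS.toFinset with hSdef
  set S' := hfinS'.toFinset with hS'def
  have hmemS : ∀ {P}, P ∈ S ↔ P ∈ topPrimesDNL d A := fun {P} => Set.Finite.mem_toFinset _
  have hmemS' : ∀ {P'}, P' ∈ S' ↔ P' ∈ topPrimesDNL d A' := fun {P'} => Set.Finite.mem_toFinset _
  -- the letter bit upstairs
  have hβ'1 : IsPermissibleTwoT d A' → betaTwo d A' N' = 1 := fun h => betaTwo_eq_one_iff.mpr (Or.inr h)
  have hβ'0 : ¬ IsPermissibleTwoT d A' → betaTwo d A' N' = 0 := fun h => by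
    refine betaTwo_eq_zero_iff.mpr ?_
    rw [hN', Finset.mem_singleton]
    exact fun h' => h'.elim (by decide) h
  -- per-branch values: `a′ = a`, `a′ + b′ = v_P(u₂ − c u₁)`
  have hvals : ∀ P' ∈ topPrimesDNL d A',
      branchVal P' (X 0) ≠ ⊤ ∧ branchVal P' (X 1) ≠ ⊤ ∧ 1 ≤ branchVal P' (X 0) ∧ 1 ≤ branchVal P' (X 1) ∧
      branchVal P' (X 0) = branchVal (ι P') (X 0) ∧
      branchVal P' (X 0) + branchVal P' (X 1) = branchVal (ι P') (X 1 - X 0 * C c) := by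
    intro P' hP'
    obtain ⟨⟨hP'top, hdim'⟩, hX0', hX1'⟩ := hP'
    haveI := hP'top.1
    obtain ⟨-, hval⟩ := hB3 P' hdim' hX0'
    refine ⟨(branchVal_eq_top_iff_of_dim hdim' _).not.mpr hX0', (branchVal_eq_top_iff_of_dim hdim' _).not.mpr hX1',
      one_le_branchVal_X_of_dim hdim' 0, one_le_branchVal_X_of_dim hdim' 1, ?_, ?_⟩
    · rw [hιdef]; show branchVal P' (X 0) = branchVal (P'.comap Φ) (X 0); rw [hval, hΦX0]
    · rw [hιdef]; show _ = branchVal (P'.comap Φ) (X 1 - X 0 * C c); rw [hval, hΦℓ, branchVal_mul_of_dim hdim']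
  -- the slack
  set s : Ideal (MvPowerSeries (Fin 3) k) → ℕ := fun P' => if IsPermissibleTwoT d A' then 1 else betaTwo d A N * kappa (ι P')
    with hsdef
  -- charges
  have hc : ∀ P' ∈ S', charge d A' N' P' + s P' ≤ charge d A N (ι P') +
      2 * ∑ Q ∈ S.filter (fun Q => Q ∉ S'.image ι), ((pairVal (ι P') Q).toNat + (pairVal Q (ι P')).toNat) := by
    intro P' hP'
    have hP'm := hmemS'.mp hP'
    obtain ⟨ha', hb', h1a, h1b, haa, hab⟩ := hvals P' hP'm
    have haa' : (branchVal P' (X 0)).toNat = (branchVal (ι P') (X 0)).toNat := by rw [haa]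
    have h1a' := one_le_toNat h1a ha'
    have h1b' := one_le_toNat h1b hb'
    by_cases hperm : IsPermissibleTwoT d A'
    · -- births, paid by the dying line prime
      obtain ⟨L', hL'top, hX1L, hX0L, hdimL⟩ := hline hperm
      haveI := hL'top.1
      have hLmem : ι L' ∈ topPrimesDNL d A := hιmem' L' hL'top hdimL hX0L
      haveI : (ι L').IsPrime := hLmem.1.1.1
      haveI : (ι P').IsPrime := (hιmem P' hP'm).1.1.1
      have hLdying : ι L' ∈ S.filter (fun Q => Q ∉ S'.image ι) := by
        refine mem_filter_not_mem_image.mpr ⟨hmemS.mpr hLmem, fun Q' hQ' hQ => ?_⟩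
        have hQ'm := hmemS'.mp hQ'
        have hQL : Q' = L' := hinj Q' L' hQ'm.1.1.1 hL'top.1 hQ'm.1.2 hdimL hQ'm.2.1 hX0L hQ
        exact hQ'm.2.2 (by rw [hQL]; exact hX1L)
      have hne : ι P' ≠ ι L' := fun h => by
        have hPL : P' = L' := hinj P' L' hP'm.1.1.1 hL'top.1 hP'm.1.2 hdimL hP'm.2.1 hX0L h
        exact hP'm.2.2 (by rw [hPL]; exact hX1L)
      have hℓL : (X 1 - X 0 * C c : MvPowerSeries (Fin 3) k) ∈ ι L' := by
        rw [hιdef, Ideal.mem_comap]; show Φ (X 1 - X 0 * C c) ∈ L'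
        rw [hΦℓ]; exact Ideal.mul_mem_left _ _ hX1L
      -- `pair(P, P_ℓ) ≥ v_P(u₂ − c u₁)` by D7
      have hpair : branchVal (ι P') (X 1 - X 0 * C c) ≤ pairVal (ι P') (ι L') := by
        rw [pairVal]
        refine le_iInf fun g => ?_
        obtain ⟨g, hgL, hgP⟩ := g
        have hmem : (X 1 - X 0 * toThree (C c : MvPowerSeries (Fin 2) k) : MvPowerSeries (Fin 3) k) ∈ ι L' := by
          rw [toThree_C]; exact hℓL
        have hnoY : ∀ e : Fin 2 →₀ ℕ, e 1 ≠ 0 → coeff e (C c : MvPowerSeries (Fin 2) k) = 0 := fun e he => by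
          rw [coeff_C, if_neg]; rintro rfl; exact he rfl
        obtain ⟨q, hq⟩ := dvd_of_toThree_mem hLmem.2.1 hnoY hmem hgL
        show branchVal (ι P') (X 1 - X 0 * C c) ≤ branchVal (ι P') (toThree g)
        have hg3 : toThree g = (X 1 - X 0 * C c) * toThree q := by
          rw [hq, map_mul, map_sub, map_mul, toThree_X, toThree_X, toThree_C]; rfl
        rw [hg3, branchVal_mul_of_dim (hιmem P' hP'm).1.2]
        exact le_self_add
      have hfinpair : pairVal (ι P') (ι L') < ⊤ :=
        hD3 _ _ (hιmem P' hP'm).1.1 hLmem.1.1 hne (hιmem P' hP'm).1.2 hLmem.1.2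
      have hsingle : (pairVal (ι P') (ι L')).toNat + (pairVal (ι L') (ι P')).toNat ≤
          ∑ Q ∈ S.filter (fun Q => Q ∉ S'.image ι), ((pairVal (ι P') Q).toNat + (pairVal Q (ι P')).toNat) :=
        Finset.single_le_sum (f := fun Q => (pairVal (ι P') Q).toNat + (pairVal Q (ι P')).toNat) (fun _ _ => Nat.zero_le _) hLdying
      have hab' : (branchVal P' (X 0)).toNat + (branchVal P' (X 1)).toNat ≤ (pairVal (ι P') (ι L')).toNat := by
        rw [← ENat.toNat_add ha' hb', hab]
        exact ENat.toNat_le_toNat hpair hfinpair.ne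
      have hs1 : s P' = 1 := by simp [hsdef, hperm]
      rw [hs1, charge_eq d A' N', hβ'1 hperm, charge_eq d A N, branchMult, toNat_min_of_ne_top ha' hb']
      have hκ' := kappa_le_one P'
      have h0 : 0 ≤ betaTwo d A N * (2 * ((branchVal (ι P') (X 1)).toNat - (branchMult (ι P')).toNat) + kappa (ι P')) := Nat.zero_le _
      omega
    · -- no births: the new charge is `2a′ = 2a`
      have hs0 : s P' = betaTwo d A N * kappa (ι P') := by simp [hsdef, hperm]
      rw [hs0, charge_eq d A' N', hβ'0 hperm, charge_eq d A N, zero_mul, add_zero]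
      have hmono : betaTwo d A N * kappa (ι P') ≤
          betaTwo d A N * (2 * ((branchVal (ι P') (X 1)).toNat - (branchMult (ι P')).toNat) + kappa (ι P')) :=
        Nat.mul_le_mul_left _ (by omega)
      omega
  -- surviving pairs do not increase
  have hq : ∀ P' ∈ S', ∀ Q' ∈ S', P' ≠ Q' → (pairVal P' Q').toNat ≤ (pairVal (ι P') (ι Q')).toNat := by
    intro P' hP' Q' hQ' hne
    have hP'm := hmemS'.mp hP'
    have hQ'm := hmemS'.mp hQ'
    haveI := hP'm.1.1.1
    haveI := hQ'm.1.1.1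
    obtain ⟨-, hval⟩ := hB3 P' hP'm.1.2 hP'm.2.1
    have hle : pairVal P' Q' + branchVal P' (X 0) ≤ pairVal (ι P') (ι Q') :=
      pairVal_add_le_of_transport Φ.toRingHom (subst (![X 0, X 0 * (X 1 + C c)] : Fin 2 → MvPowerSeries (Fin 2) k)) hΦ₂ hP'm.1.2
        rfl rfl (fun f => (hval f).symm ▸ rfl) (X 0) hQ'm.2.1 fun g hg0 => by
          obtain ⟨ĝ, hĝ⟩ := exists_chartTranslated_eq_mul c hg0
          exact ⟨ĝ, by rw [hĝ, map_mul, toThree_X]; rfl⟩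
    have hιne : ι P' ≠ ι Q' := fun h => hne (hinjOn hP'm hQ'm h)
    have hfin : pairVal (ι P') (ι Q') < ⊤ :=
      hD3 _ _ (hιmem P' hP'm).1.1 (hιmem Q' hQ'm).1.1 hιne (hιmem P' hP'm).1.2 (hιmem Q' hQ'm).1.2
    exact ENat.toNat_le_toNat (le_trans le_self_add hle) hfin.ne
  -- the comparison
  have hιS : ∀ P' ∈ S', ι P' ∈ S := fun P' hP' => hmemS.mpr (hιmem P' (hmemS'.mp hP'))
  have hinjS : Set.InjOn ι S' := fun P' hP' Q' hQ' h => hinjOn (hmemS'.mp hP') (hmemS'.mp hQ') h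
  have hmain := budget_comparison S' S ι hιS hinjS (charge d A' N') s (charge d A N)
    (fun P' Q' => (pairVal P' Q').toNat) (fun P Q => (pairVal P Q).toNat) hq hc
  rw [conflictBudgetD_eq_sum hfinS' N', conflictBudgetD_eq_sum hfinS N, ← hSdef, ← hS'def]
  refine ⟨by omega, fun P₀ hP₀ hβ1 ha1 => ?_⟩
  -- strictness: `P₀` dies (charge ≥ 2 freed) or survives (slack ≥ 1)
  by_cases hsurv : ∃ P' ∈ S', ι P' = P₀
  · obtain ⟨P', hP', hP'eq⟩ := hsurv
    have hs1 : 1 ≤ s P' := by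
      by_cases hperm : IsPermissibleTwoT d A'
      · simp [hsdef, hperm]
      · rw [show s P' = betaTwo d A N * kappa (ι P') by simp [hsdef, hperm], hP'eq]
        have hP'm := hmemS'.mp hP'
        obtain ⟨-, -, -, h1b, haa, hab⟩ := hvals P' hP'm
        rw [hP'eq] at haa hab
        haveI := hP₀.1.1.1
        have h2 : 2 ≤ branchVal P₀ (X 1 - X 0 * C c) := by
          rw [← hab, haa, ha1]
          calc (2 : ℕ∞) = 1 + 1 := one_add_one_eq_two.symm
            _ ≤ 1 + branchVal P' (X 1) := add_le_add_right h1b 1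
        have hκ : kappa P₀ = 1 := kappa_eq_one_iff.mpr ⟨ha1, branchVal_X_one_eq_one_of_contact hP₀.1.2 hc0 ha1 h2⟩
        rw [hκ, mul_one]; exact hβ1
    have h1 : s P' ≤ ∑ P' ∈ S', s P' := Finset.single_le_sum (f := s) (fun _ _ => Nat.zero_le _) hP'
    omega
  · push Not at hsurv
    have hP₀S : P₀ ∈ S := hmemS.mpr hP₀
    have hmem : P₀ ∈ S.filter (fun Q => Q ∉ S'.image ι) := mem_filter_not_mem_image.mpr ⟨hP₀S, hsurv⟩
    have h1 : charge d A N P₀ ≤ ∑ Q ∈ S.filter (fun Q => Q ∉ S'.image ι), charge d A N Q :=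
      Finset.single_le_sum (fun _ _ => Nat.zero_le _) hmem
    have h2 : 2 ≤ charge d A N P₀ := two_le_charge p hd2 hsq (topPrimesDNL_subset_topPrimesNL d A hP₀) N
    omega

/-- **B6 STEP TRANSLATED POINT: the conf-law** — at a conflict state the budget DROPS (the transverse branch of D5 has `a = 1`, and `β = 1`). -/
theorem conflictBudgetD_translated_lt (p : ℕ) [Fact p.Prime] [CharP k p] [IsAlgClosed k] {c : k} (hc0 : c ≠ 0)
    (hΦX0 : Φ (X 0) = X 0) (hΦX1 : Φ (X 1) = X 0 * (X 1 + C c))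
    (hΦ₂ : ∀ g : MvPowerSeries (Fin 2) k,
      Φ (toThree g) = toThree (subst (![X 0, X 0 * (X 1 + C c)] : Fin 2 → MvPowerSeries (Fin 2) k) g))
    (hB3 : ∀ (P' : Ideal (MvPowerSeries (Fin 3) k)) [P'.IsPrime], ringKrullDim (MvPowerSeries (Fin 3) k ⧸ P') = 1 →
      (X 0 : MvPowerSeries (Fin 3) k) ∉ P' →
      ringKrullDim (MvPowerSeries (Fin 3) k ⧸ P'.comap Φ) = 1 ∧ ∀ f, branchVal (P'.comap Φ) f = branchVal P' (Φ f))
    (hB4 : ∀ (P' : Ideal (MvPowerSeries (Fin 3) k)), P' ∈ topPrimes d A' → (X 0 : MvPowerSeries (Fin 3) k) ∉ P' →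
      P'.comap Φ ∈ topPrimes d A)
    (hD3 : ∀ (P Q : Ideal (MvPowerSeries (Fin 3) k)), P ∈ topPrimes d A → Q ∈ topPrimes d A → P ≠ Q →
      ringKrullDim (MvPowerSeries (Fin 3) k ⧸ P) = 1 → ringKrullDim (MvPowerSeries (Fin 3) k ⧸ Q) = 1 → pairVal P Q < ⊤)
    (hinj : ∀ (P' Q' : Ideal (MvPowerSeries (Fin 3) k)), P'.IsPrime → Q'.IsPrime → ringKrullDim (MvPowerSeries (Fin 3) k ⧸ P') = 1 →
      ringKrullDim (MvPowerSeries (Fin 3) k ⧸ Q') = 1 → (X 0 : MvPowerSeries (Fin 3) k) ∉ P' → (X 0 : MvPowerSeries (Fin 3) k) ∉ Q' →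
      P'.comap Φ = Q'.comap Φ → P' = Q')
    (hline : IsPermissibleTwoT d A' → ∃ L' ∈ topPrimes d A', (X 1 : MvPowerSeries (Fin 3) k) ∈ L' ∧
      (X 0 : MvPowerSeries (Fin 3) k) ∉ L' ∧ ringKrullDim (MvPowerSeries (Fin 3) k ⧸ L') = 1)
    (hctx : ∃ (b : MvPowerSeries (Fin (2 + 1)) k) (δ : TameFourTupleDrop.Decoration k 2) (Θ : Fin (2 + 1) → MvPowerSeries (Fin (2 + 1)) k),
      TameFourTupleDrop.Admissible b δ ∧ 2 ≤ δ.o ∧ δ.c = d ∧ δ.PresBy d A N Θ)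
    (hin : InPoly d A) (hconf : NCPoly.Conflict d A N) (hN' : N' = {0}) :
    conflictBudgetD d A' N' < conflictBudgetD d A N := by
  have hd2 : 2 ≤ d := NCBranchPrimes.two_le_of_presContext hctx
  have hsq : Squarefree (NCPoly.monicGerm d A) := NCBranchPrimes.squarefree_monicGerm_of_presContext hctx
  obtain ⟨P₀, hP₀, ha1⟩ := exists_transverse_of_conflict p hctx hin hconf
  have hP₀D : P₀ ∈ topPrimesDNL d A := mem_topPrimesDNL_of_mem_topPrimesNL hP₀ (ringKrullDim_eq_one_of_mem_topPrimes p hd2 hsq hP₀.1)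
  have hβ1 : 1 ≤ betaTwo d A N := by rw [(betaTwo_eq_one_iff).mpr (Or.inl hconf.2.2.2)]
  exact (conflictBudgetD_translated_le Φ p hc0 hΦX0 hΦX1 hΦ₂ hB3 hB4 hD3 hinj hline hctx hN').2 P₀ hP₀D hβ1 ha1

end Step

end TOT2Branch

end Summit.ResolutionOfSingularities.ResolutionOfSingularities.Theorems

end
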